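import Mathlib
import Summits.NavierStokesRegularity.FluidComputer.AbcContestIR300
import Summits.NavierStokesRegularity.FluidComputer.AbcContestIR500
import Summits.NavierStokesRegularity.FluidComputer.AbcInertiaCIExactlyPairOfBases

/-!
# CONTEST-I AT R 300 AND THE LEADER AT R 500 — ALL FOUR INERTIA CELLS IN ARBITRARY REAL ORTHONORMAL ORBIT BASES
# (the AUDIT-BASIS form of `AbcContestIR300` / `AbcContestIR500`; instab3 g9, cell `ns-blowup`, 2026-08-27)

HONEST FRAMING (human rulings D-0035/D-0074): **MODEL linear operator, computer-assisted; not NS.** Nothing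
here is a statement about Navier–Stokes regularity or blow-up. Object: the linearisation of forced NS about
`U = abcFlow 1 1 1` on the unit torus at viscosity `1/(2πR)`, `R ∈ {300, 500}`, symmetry classes I and II
separately (classes III–V untreated). bears_on LADDER-NS N1* T6 (contest-I at R 300, leader order at R 500,
LEADER FLIP I → II) / profile W3. WHAT THIS IS NOT: not NS; no certificate re-run; no number or census word
moves; kernel IMPLICATIONS whose hypotheses are the finite-matrix facts the certificates print.

`AbcContestIR300.contestI_R300_i3` and `AbcContestIR500.contestI_R500_i4` carry the class-I INERTIA facts on the
tree's coordinates `AbcClassI.amat` (existential bases). Here BOTH INERTIA cells of each sentence are stated in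
ARBITRARY families of real orthonormal orbit bases — class II: `e` (basis families `bf`, first-order matrix `am`,
as in `AbcInertiaBases`); class I: `eI` (`brI`, `amI`, as in `AbcInertiaCIBases`) — and both T-rows in arbitrary
admissible complex orbit bases (`wf`, `wfI`), so every hypothesis family reads in the basis ITS certifier computed
in, modulo the common AUDIT-BASIS clause. Conclusions identical to the two files':
* **`contestI_R300_of_bases`** (implementation 1's INERTIA cells: class II `(28, 30)` j269623, class I `(26, 28)`
  j269622): `λ_II` real and ALL of `σ_p(L₃₀₀|II) ∩ {Re ≥ 1/5}`, the Hopf pair ALL of `σ_p(L₃₀₀|I) ∩ {Re ≥ 43/200}`,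
  and `Re z < Re λ_I` for EVERY classical class-II eigenpair — CLASS I LEADS at R 300;
* **`contestI_R500_of_bases`** (implementation 2's INERTIA cells `(36, 37)` ×2, j274542/j274818): the same shape
  at R 500 with `Re z < Re λ_II` for EVERY classical class-I eigenpair — CLASS II LEADS at R 500.
What is NOT kernel: the rows' primary interval outputs and (R1)(R2) = the programs' verified arithmetic
(R 500 INERTIA: single implementation), AUDIT-BASIS (one clause, all four bases), classes III–V.

Mathlib + the three files named; no new definitions; std axioms. [folklore]
-/

noncomputable section

open scoped BigOperators ComplexConjugate InnerProductSpace Matrix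
open Finset Matrix MeasureTheory UnitAddTorus

namespace Summit.NavierStokesRegularity.FluidComputer.AbcContestI

open Literature.Analysis.FunctionSpaces Literature.Analysis.FunctionSpaces.Torus
open Literature.Analysis.FunctionSpaces.EuclideanSpace
open Literature.Analysis.FluidPDE Literature.Analysis.FluidPDE.SteadyLattice
open Summit.NavierStokesRegularity.FluidComputer.AbcClassII
open Summit.NavierStokesRegularity.FluidComputer.AbcClassI (IsClassI)
open Summit.NavierStokesRegularity.FluidComputer.CertificateAbcSpectrum

section Rows

variable (wf : Idx → Fam)
variable (hws : ∀ i : Idx, ∀ k ∉ i.1.1, wf i k = 0)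
variable (hwt : ∀ (i : Idx) (k : Fin 3 → ℤ), ∑ j : Fin 3, ((k j : ℤ) : ℂ) * wf i k j = 0)
variable (hwII : ∀ i : Idx, IsClassII (wf i))
variable (hwon : ∀ (O : Orbit) (a b : Fin (odim O)),
  ∑ k ∈ O.1, (inner ℂ (wf ⟨O, a⟩ k) (wf ⟨O, b⟩ k) : ℂ) = if a = b then 1 else 0)
variable (amc : Idx → Idx → ℂ)
variable (hamc : ∀ i j : Idx, amc i j =
  ∑ k ∈ i.1.1, (inner ℂ (wf i k) (Torus.lerayCoeff k (crossForm 1 1 1 (wf j) k)) : ℂ))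
variable (e : ∀ O : Orbit, OrthonormalBasis (Fin (odim O)) ℝ (realSpace O.1))
variable (bf : Idx → Fam)
variable (hbf : ∀ i : Idx, bf i = extend i.1.1 ((e i.1 i.2 : realSpace i.1.1) : EuclideanSpace ℂ (↥i.1.1 × Fin 3)))
variable (am : Idx → Idx → ℝ)
variable (ham : ∀ i j : Idx, am i j =
  (∑ k ∈ i.1.1, (inner ℂ (bf i k) (Torus.lerayCoeff k (crossForm 1 1 1 (bf j) k)) : ℂ)).re)
variable (wfI : AbcClassI.Idx → Fam)
variable (hwsI : ∀ i : AbcClassI.Idx, ∀ k ∉ i.1.1, wfI i k = 0)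
variable (hwtI : ∀ (i : AbcClassI.Idx) (k : Fin 3 → ℤ), ∑ j : Fin 3, ((k j : ℤ) : ℂ) * wfI i k j = 0)
variable (hwI : ∀ i : AbcClassI.Idx, IsClassI (wfI i))
variable (hwonI : ∀ (O : Orbit) (a b : Fin (AbcClassI.odim O)),
  ∑ k ∈ O.1, (inner ℂ (wfI ⟨O, a⟩ k) (wfI ⟨O, b⟩ k) : ℂ) = if a = b then 1 else 0)
variable (amcI : AbcClassI.Idx → AbcClassI.Idx → ℂ)
variable (hamcI : ∀ i j : AbcClassI.Idx, amcI i j =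
  ∑ k ∈ i.1.1, (inner ℂ (wfI i k) (Torus.lerayCoeff k (crossForm 1 1 1 (wfI j) k)) : ℂ))
variable (eI : ∀ O : Orbit, OrthonormalBasis (Fin (AbcClassI.odim O)) ℝ (AbcClassI.realSpace O.1))
variable (brI : AbcClassI.Idx → Fam)
variable (hbrI : ∀ i : AbcClassI.Idx, brI i = extend i.1.1 ((eI i.1 i.2 : AbcClassI.realSpace i.1.1) : EuclideanSpace ℂ (↥i.1.1 × Fin 3)))
variable (amI : AbcClassI.Idx → AbcClassI.Idx → ℝ)
variable (hamI : ∀ i j : AbcClassI.Idx, amI i j =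
  (∑ k ∈ i.1.1, (inner ℂ (brI i k) (Torus.lerayCoeff k (crossForm 1 1 1 (brI j) k)) : ℂ)).re)

include hws hwt hwII hwon hamc hbf ham hwsI hwtI hwI hwonI hamcI hbrI hamI in
/-- **CONTEST-I AT R = 300, ALL CELLS IN ARBITRARY BASES — implementation 1's INERTIA cells.** T1 row `Row3002C` (class II, complex bases `wf`) + INERTIA `(300, II, 1/5, 1; 28, 30)` in the real orthonormal class-II orbit bases `e` + T2 row `Row3001C` (class I, complex bases `wfI`) + INERTIA `(300, I, 43/200, 2; 26, 28)` in the real orthonormal CLASS-I orbit bases `eI` ⇒ `λ_II` real = ALL of `σ_p(L|II) ∩ {Re ≥ 1/5}`, the Hopf pair = ALL of `σ_p(L|I) ∩ {Re ≥ 43/200}`, `λ_II < Re λ_I`, and `Re z < Re λ_I` for EVERY classical class-II eigenpair. MODEL; conditional on the four certifier audits and the single AUDIT-BASIS clause; classes III–V untreated. -/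
theorem contestI_R300_of_bases
    (vt : Idx → ℂ) (hvt0 : ∀ i, i ∉ cubeIdx 96 → vt i = 0)
    (hres : ∑ i ∈ cubeIdx 96 ∪ (cubeIdx 96).biUnion nbrIdx,
      ‖(if i ∈ cubeIdx 96 then ((((Row3002C.lamRe : ℚ) : ℝ) : ℂ) - ((-(onormSq i.1 / 300) : ℝ) : ℂ)) * vt i
          else 0) - ∑ j ∈ cubeIdx 96, amc i j * vt j‖ ^ 2 ≤ ((Row3002C.rnorm : ℚ) : ℝ) ^ 2)
    (hntb : ∑ i ∈ cubeIdx 96 \ cubeIdx 22, ‖vt i‖ ^ 2 ≤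
      (((5848008621608657 : ℚ) / 576460752303423488 : ℚ) : ℝ) ^ 2)
    (Binv : ((↥(cubeIdx 22) → ℂ) × ℂ) →ₗ[ℂ] ((↥(cubeIdx 22) → ℂ) × ℂ))
    (hBinv : ∀ (c : ↥(cubeIdx 22) → ℂ) (m : ℂ),
      Binv (fun i : ↥(cubeIdx 22) =>
          ((((Row3002C.lamRe : ℚ) : ℝ) : ℂ) - ((-(onormSq i.1.1 / 300) : ℝ) : ℂ)) * c i -
          ∑ j : ↥(cubeIdx 22), amc i j * c j + m * vt i,
        ∑ i : ↥(cubeIdx 22), conj (vt i) * c i) = (c, m))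
    (hαM : ∀ (c : ↥(cubeIdx 22) → ℂ) (g : ℂ),
      ∑ j : ↥(cubeIdx 22), ‖(Binv (c, g)).1 j‖ ^ 2 + ‖(Binv (c, g)).2‖ ^ 2 ≤
        ((Row3002C.alpha0 : ℚ) : ℝ) ^ 2 * (∑ i : ↥(cubeIdx 22), ‖c i‖ ^ 2 + ‖g‖ ^ 2))
    (hβBM : ∀ w : Idx → ℂ,
      ∑ j : ↥(cubeIdx 22), ‖(Binv (fun i : ↥(cubeIdx 22) => -∑ j ∈ nbrIdx i \ cubeIdx 22,
          amc i j * w j, 0)).1 j‖ ^ 2 +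
        ‖(Binv (fun i : ↥(cubeIdx 22) => -∑ j ∈ nbrIdx i \ cubeIdx 22,
          amc i j * w j, 0)).2‖ ^ 2 ≤
        ((Row3002C.betaB : ℚ) : ℝ) ^ 2 * ∑ j ∈ (cubeIdx 22).biUnion nbrIdx \ cubeIdx 22, ‖w j‖ ^ 2)
    (hβCM : ∀ (c : ↥(cubeIdx 22) → ℂ) (g : ℂ),
      ∑ i ∈ ((cubeIdx 22).biUnion nbrIdx ∪ cubeIdx 96) \ cubeIdx 22,
        ‖-∑ j : ↥(cubeIdx 22), amc i j * (Binv (c, g)).1 j +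
          (Binv (c, g)).2 * vt i‖ ^ 2 ≤
        ((Row3002C.betaC : ℚ) : ℝ) ^ 2 * (∑ i : ↥(cubeIdx 22), ‖c i‖ ^ 2 + ‖g‖ ^ 2))
    (hgBM : ∀ w : Idx → ℂ,
      ‖(Binv (fun i : ↥(cubeIdx 22) => ∑ j ∈ nbrIdx i \ cubeIdx 22,
          amc i j * w j, 0)).2‖ ^ 2 ≤
        (((959475027496217 : ℚ) / 281474976710656 : ℚ) : ℝ) ^ 2 *
          ∑ j ∈ (cubeIdx 22).biUnion nbrIdx \ cubeIdx 22, ‖w j‖ ^ 2)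
    (hshellM : ∀ w : Idx → ℂ, (∀ i ∈ cubeIdx 22, w i = 0) →
      (((5501868957119981 : ℚ) / 9007199254740992 : ℚ) : ℝ) * ∑ i ∈ cubeIdx (22 + 1) \ cubeIdx 22, ‖w i‖ ^ 2 ≤
        ∑ i ∈ cubeIdx (22 + 1) \ cubeIdx 22,
          ((((Row3002C.lamRe : ℚ) : ℝ) : ℂ).re - (-(onormSq i.1 / 300)) - Real.sqrt 2) * ‖w i‖ ^ 2 -
        RCLike.re (∑ i ∈ (cubeIdx 22).biUnion nbrIdx \ cubeIdx 22,
          conj (∑ j : ↥(cubeIdx 22), amc i j *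
            (Binv (fun i : ↥(cubeIdx 22) => ∑ j ∈ nbrIdx i \ cubeIdx 22,
              amc i j * w j, 0)).1 j) * w i))
    {HL HH HB : Finset Idx}
    (hHL : ∀ i : Idx, i ∈ HL ↔ onormSq i.1 ≤ (28 : ℝ) ^ 2)
    (hHH : ∀ i : Idx, i ∈ HH ↔ onormSq i.1 ≤ (30 : ℝ) ^ 2)
    (hHB : ∀ i : Idx, i ∈ HB ↔ (30 : ℝ) ^ 2 < onormSq i.1 ∧ onormSq i.1 ≤ ((30 : ℝ) + 1) ^ 2)
    (GH' Ah' : Matrix ↥HH ↥HH ℝ) (AHB' : Matrix ↥HH ↥HB ℝ) (ABH' : Matrix ↥HB ↥HH ℝ) (E : ↥HB → ℝ)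
    (V' : Matrix ↥HH (Fin 1) ℝ) (hGH' : GH'ᵀ = GH')
    (hAh' : Ah' = Matrix.of fun i j : ↥HH =>
      (if i = j then -(onormSq i.1.1 / (300 : ℝ)) - (1 / 5 : ℝ) else 0) + am i.1 j.1)
    (hAHB' : AHB' = Matrix.of fun (i : ↥HH) (l : ↥HB) => am i.1 l.1)
    (hABH' : ABH' = Matrix.of fun (l : ↥HB) (i : ↥HH) => am l.1 i.1)
    (hE : E = fun l : ↥HB => onormSq l.1.1 / (300 : ℝ) + (1 / 5 : ℝ) - Real.sqrt 2)
    (hR1' : ∀ x : ↥HH → ℝ, x ≠ 0 →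
      x ⬝ᵥ ((GH' * Ah' + Ah'ᵀ * GH' + (1 / 2 : ℝ) • ((GH' * AHB' + ABH'ᵀ) * Matrix.diagonal (fun l => (E l)⁻¹) *
        (GH' * AHB' + ABH'ᵀ)ᵀ)) *ᵥ x) < 0)
    (hR2' : ∀ x : ↥HH → ℝ, 0 ≤ x ⬝ᵥ ((GH' + V' * V'ᵀ) *ᵥ x))
    (vtI : AbcClassI.Idx → ℂ) (hvt0I : ∀ i, i ∉ AbcClassI.cubeIdx 96 → vtI i = 0)
    (hresI : ∑ i ∈ AbcClassI.cubeIdx 96 ∪ (AbcClassI.cubeIdx 96).biUnion AbcClassI.nbrIdx,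
      ‖(if i ∈ AbcClassI.cubeIdx 96 then (((((Row3001C.lamRe : ℚ) : ℝ) : ℂ) + (((Row3001C.lamIm : ℚ) : ℝ) : ℂ) * Complex.I) - ((-(onormSq i.1 / 300) : ℝ) : ℂ)) * vtI i
          else 0) - ∑ j ∈ AbcClassI.cubeIdx 96, amcI i j * vtI j‖ ^ 2 ≤ ((Row3001C.rnorm : ℚ) : ℝ) ^ 2)
    (hntbI : ∑ i ∈ AbcClassI.cubeIdx 96 \ AbcClassI.cubeIdx 22, ‖vtI i‖ ^ 2 ≤
      (((2315674124931519 : ℚ) / 288230376151711744 : ℚ) : ℝ) ^ 2)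
    (BinvI : ((↥(AbcClassI.cubeIdx 22) → ℂ) × ℂ) →ₗ[ℂ] ((↥(AbcClassI.cubeIdx 22) → ℂ) × ℂ))
    (hBinvI : ∀ (c : ↥(AbcClassI.cubeIdx 22) → ℂ) (m : ℂ),
      BinvI (fun i : ↥(AbcClassI.cubeIdx 22) =>
          (((((Row3001C.lamRe : ℚ) : ℝ) : ℂ) + (((Row3001C.lamIm : ℚ) : ℝ) : ℂ) * Complex.I) - ((-(onormSq i.1.1 / 300) : ℝ) : ℂ)) * c i -
          ∑ j : ↥(AbcClassI.cubeIdx 22), amcI i j * c j + m * vtI i,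
        ∑ i : ↥(AbcClassI.cubeIdx 22), conj (vtI i) * c i) = (c, m))
    (hαMI : ∀ (c : ↥(AbcClassI.cubeIdx 22) → ℂ) (g : ℂ),
      ∑ j : ↥(AbcClassI.cubeIdx 22), ‖(BinvI (c, g)).1 j‖ ^ 2 + ‖(BinvI (c, g)).2‖ ^ 2 ≤
        ((Row3001C.alpha0 : ℚ) : ℝ) ^ 2 * (∑ i : ↥(AbcClassI.cubeIdx 22), ‖c i‖ ^ 2 + ‖g‖ ^ 2))
    (hβBMI : ∀ w : AbcClassI.Idx → ℂ,
      ∑ j : ↥(AbcClassI.cubeIdx 22), ‖(BinvI (fun i : ↥(AbcClassI.cubeIdx 22) => -∑ j ∈ AbcClassI.nbrIdx i \ AbcClassI.cubeIdx 22,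
          amcI i j * w j, 0)).1 j‖ ^ 2 +
        ‖(BinvI (fun i : ↥(AbcClassI.cubeIdx 22) => -∑ j ∈ AbcClassI.nbrIdx i \ AbcClassI.cubeIdx 22,
          amcI i j * w j, 0)).2‖ ^ 2 ≤
        ((Row3001C.betaB : ℚ) : ℝ) ^ 2 * ∑ j ∈ (AbcClassI.cubeIdx 22).biUnion AbcClassI.nbrIdx \ AbcClassI.cubeIdx 22, ‖w j‖ ^ 2)
    (hβCMI : ∀ (c : ↥(AbcClassI.cubeIdx 22) → ℂ) (g : ℂ),
      ∑ i ∈ ((AbcClassI.cubeIdx 22).biUnion AbcClassI.nbrIdx ∪ AbcClassI.cubeIdx 96) \ AbcClassI.cubeIdx 22,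
        ‖-∑ j : ↥(AbcClassI.cubeIdx 22), amcI i j * (BinvI (c, g)).1 j +
          (BinvI (c, g)).2 * vtI i‖ ^ 2 ≤
        ((Row3001C.betaC : ℚ) : ℝ) ^ 2 * (∑ i : ↥(AbcClassI.cubeIdx 22), ‖c i‖ ^ 2 + ‖g‖ ^ 2))
    (hgBMI : ∀ w : AbcClassI.Idx → ℂ,
      ‖(BinvI (fun i : ↥(AbcClassI.cubeIdx 22) => ∑ j ∈ AbcClassI.nbrIdx i \ AbcClassI.cubeIdx 22,
          amcI i j * w j, 0)).2‖ ^ 2 ≤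
        (((2617195581838679 : ℚ) / 2251799813685248 : ℚ) : ℝ) ^ 2 *
          ∑ j ∈ (AbcClassI.cubeIdx 22).biUnion AbcClassI.nbrIdx \ AbcClassI.cubeIdx 22, ‖w j‖ ^ 2)
    (hshellMI : ∀ w : AbcClassI.Idx → ℂ, (∀ i ∈ AbcClassI.cubeIdx 22, w i = 0) →
      (((5524214073445137 : ℚ) / 9007199254740992 : ℚ) : ℝ) * ∑ i ∈ AbcClassI.cubeIdx (22 + 1) \ AbcClassI.cubeIdx 22, ‖w i‖ ^ 2 ≤
        ∑ i ∈ AbcClassI.cubeIdx (22 + 1) \ AbcClassI.cubeIdx 22,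
          (((((Row3001C.lamRe : ℚ) : ℝ) : ℂ) + (((Row3001C.lamIm : ℚ) : ℝ) : ℂ) * Complex.I).re - (-(onormSq i.1 / 300)) - Real.sqrt 2) * ‖w i‖ ^ 2 -
        RCLike.re (∑ i ∈ (AbcClassI.cubeIdx 22).biUnion AbcClassI.nbrIdx \ AbcClassI.cubeIdx 22,
          conj (∑ j : ↥(AbcClassI.cubeIdx 22), amcI i j *
            (BinvI (fun i : ↥(AbcClassI.cubeIdx 22) => ∑ j ∈ AbcClassI.nbrIdx i \ AbcClassI.cubeIdx 22,
              amcI i j * w j, 0)).1 j) * w i))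
    {HLI HHI HBI : Finset AbcClassI.Idx}
    (hHLI : ∀ i : AbcClassI.Idx, i ∈ HLI ↔ onormSq i.1 ≤ (26 : ℝ) ^ 2)
    (hHHI : ∀ i : AbcClassI.Idx, i ∈ HHI ↔ onormSq i.1 ≤ (28 : ℝ) ^ 2)
    (hHBI : ∀ i : AbcClassI.Idx, i ∈ HBI ↔ (28 : ℝ) ^ 2 < onormSq i.1 ∧ onormSq i.1 ≤ ((28 : ℝ) + 1) ^ 2)
    (GHI AhI : Matrix ↥HHI ↥HHI ℝ) (AHBI : Matrix ↥HHI ↥HBI ℝ) (ABHI : Matrix ↥HBI ↥HHI ℝ) (EI : ↥HBI → ℝ)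
    (VI : Matrix ↥HHI (Fin 2) ℝ) (hGHI : GHIᵀ = GHI)
    (hAhI : AhI = Matrix.of fun i j : ↥HHI =>
      (if i = j then -(onormSq i.1.1 / (300 : ℝ)) - (43 / 200 : ℝ) else 0) + amI i.1 j.1)
    (hAHBI : AHBI = Matrix.of fun (i : ↥HHI) (l : ↥HBI) => amI i.1 l.1)
    (hABHI : ABHI = Matrix.of fun (l : ↥HBI) (i : ↥HHI) => amI l.1 i.1)
    (hEI : EI = fun l : ↥HBI => onormSq l.1.1 / (300 : ℝ) + (43 / 200 : ℝ) - Real.sqrt 2)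
    (hR1I : ∀ x : ↥HHI → ℝ, x ≠ 0 →
      x ⬝ᵥ ((GHI * AhI + AhIᵀ * GHI + (1 / 2 : ℝ) • ((GHI * AHBI + ABHIᵀ) * Matrix.diagonal (fun l => (EI l)⁻¹) *
        (GHI * AHBI + ABHIᵀ)ᵀ)) *ᵥ x) < 0)
    (hR2I : ∀ x : ↥HHI → ℝ, 0 ≤ x ⬝ᵥ ((GHI + VI * VIᵀ) *ᵥ x)) :
    ∃ lamII lamI : ℂ,
      ‖lamII - (((Row3002C.lamRe : ℚ) : ℝ) : ℂ)‖ ≤ ((Row3002C.rho : ℚ) : ℝ) ∧ lamII.im = 0 ∧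
      ‖lamI - ((((Row3001C.lamRe : ℚ) : ℝ) : ℂ) + (((Row3001C.lamIm : ℚ) : ℝ) : ℂ) * Complex.I)‖ ≤
        ((Row3001C.rho : ℚ) : ℝ) ∧ 0 < lamI.im ∧ lamII.re < lamI.re ∧
      (∃ u : UnitAddTorus (Fin 3) → EuclideanSpace ℂ (Fin 3),
        Torus.LinNSResolventRel (1 / (2 * Real.pi * 300)) (Torus.abcFlow 1 1 1) (2 * Real.pi * lamII) u 0 ∧
          u ≠ 0 ∧ IsClassII (mFourierCoeff u)) ∧
      (∃ u : UnitAddTorus (Fin 3) → EuclideanSpace ℂ (Fin 3),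
        Torus.LinNSResolventRel (1 / (2 * Real.pi * 300)) (Torus.abcFlow 1 1 1) (2 * Real.pi * lamI) u 0 ∧
          u ≠ 0 ∧ IsClassI (mFourierCoeff u)) ∧
      (∃ u : UnitAddTorus (Fin 3) → EuclideanSpace ℂ (Fin 3),
        Torus.LinNSResolventRel (1 / (2 * Real.pi * 300)) (Torus.abcFlow 1 1 1) (2 * Real.pi * conj lamI) u 0 ∧
          u ≠ 0 ∧ IsClassI (mFourierCoeff u)) ∧
      (∀ (z : ℂ) (u : UnitAddTorus (Fin 3) → EuclideanSpace ℂ (Fin 3)),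
        Torus.LinNSResolventRel (1 / (2 * Real.pi * 300)) (Torus.abcFlow 1 1 1) (2 * Real.pi * z) u 0 → u ≠ 0 →
          IsClassII (mFourierCoeff u) → (1 / 5 : ℝ) ≤ z.re → z = lamII) ∧
      (∀ (z : ℂ) (u : UnitAddTorus (Fin 3) → EuclideanSpace ℂ (Fin 3)),
        Torus.LinNSResolventRel (1 / (2 * Real.pi * 300)) (Torus.abcFlow 1 1 1) (2 * Real.pi * z) u 0 → u ≠ 0 →
          IsClassI (mFourierCoeff u) → (43 / 200 : ℝ) ≤ z.re → z = lamI ∨ z = conj lamI) ∧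
      ∀ (z : ℂ) (u : UnitAddTorus (Fin 3) → EuclideanSpace ℂ (Fin 3)),
        Torus.LinNSResolventRel (1 / (2 * Real.pi * 300)) (Torus.abcFlow 1 1 1) (2 * Real.pi * z) u 0 → u ≠ 0 →
          IsClassII (mFourierCoeff u) → z.re < lamI.re := by
  obtain ⟨lamII, hcloseII, himII, hreloII, honeII, huniqII⟩ :=
    AbcInertia.R300II_exactly_one_tight_i3 wf hws hwt hwII hwon amc hamc e bf hbf am ham vt hvt0 hres hntb Binv hBinv
      hαM hβBM hβCM hgBM hshellM hHL hHH hHB GH' Ah' AHB' ABH' E V' hGH' hAh' hAHB' hABH' hE hR1' hR2'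
  obtain ⟨lamI, hcloseI, hreloI, himI, hpairI, hpaircI, huniqI⟩ :=
    AbcInertiaCI.R300I_exactly_pair_i3_of_bases wfI hwsI hwtI hwI hwonI amcI hamcI eI brI hbrI amI hamI vtI hvt0I hresI hntbI BinvI hBinvI
      hαMI hβBMI hβCMI hgBMI hshellMI hHLI hHHI hHBI GHI AhI AHBI ABHI EI VI hGHI hAhI hAHBI hABHI hEI hR1I hR2I
  have hcon := contest_of_exactly_one_of_pair (ν := 1 / (2 * Real.pi * 300)) row3002C_add_rho_lt_row3001C_sub_rho
    AbcInertia.a_le_row3002C lamII hcloseII huniqII lamI hreloI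
  obtain ⟨uII, huII, huII0, huIIcl⟩ := honeII
  exact ⟨lamII, lamI, hcloseII, himII, hcloseI, himI, hcon lamII uII huII huII0 huIIcl, ⟨uII, huII, huII0, huIIcl⟩,
    hpairI, hpaircI, huniqII, huniqI, hcon⟩

include hws hwt hwII hwon hamc hbf ham hwsI hwtI hwI hwonI hamcI hbrI hamI in
/-- **THE LEADER AT R = 500, ALL CELLS IN ARBITRARY BASES — implementation 2's INERTIA cells.** T1 row `Row5002C` (class II, complex bases `wf`) + INERTIA `(500, II, 6/25, 1; 36, 37)` in the real orthonormal class-II orbit bases `e` + T2 row `Row5001C` (class I, complex bases `wfI`) + INERTIA `(500, I, 1/4, 2; 36, 37)` in the real orthonormal CLASS-I orbit bases `eI` ⇒ `λ_II` real = ALL of `σ_p(L|II) ∩ {Re ≥ 6/25}`, the Hopf pair = ALL of `σ_p(L|I) ∩ {Re ≥ 1/4}`, `Re λ_I < λ_II`, and `Re z < Re λ_II` for EVERY classical class-I eigenpair. MODEL; conditional on the certifier audits and the single AUDIT-BASIS clause; classes III–V untreated. -/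
theorem contestI_R500_of_bases
    (vt : Idx → ℂ) (hvt0 : ∀ i, i ∉ cubeIdx 112 → vt i = 0)
    (hres : ∑ i ∈ cubeIdx 112 ∪ (cubeIdx 112).biUnion nbrIdx,
      ‖(if i ∈ cubeIdx 112 then ((((Row5002C.lamRe : ℚ) : ℝ) : ℂ) - ((-(onormSq i.1 / 500) : ℝ) : ℂ)) * vt i
          else 0) - ∑ j ∈ cubeIdx 112, amc i j * vt j‖ ^ 2 ≤ ((Row5002C.rnorm : ℚ) : ℝ) ^ 2)
    (hntb : ∑ i ∈ cubeIdx 112 \ cubeIdx 28, ‖vt i‖ ^ 2 ≤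
      (((1292560462104437 : ℚ) / 144115188075855872 : ℚ) : ℝ) ^ 2)
    (Binv : ((↥(cubeIdx 28) → ℂ) × ℂ) →ₗ[ℂ] ((↥(cubeIdx 28) → ℂ) × ℂ))
    (hBinv : ∀ (c : ↥(cubeIdx 28) → ℂ) (m : ℂ),
      Binv (fun i : ↥(cubeIdx 28) =>
          ((((Row5002C.lamRe : ℚ) : ℝ) : ℂ) - ((-(onormSq i.1.1 / 500) : ℝ) : ℂ)) * c i -
          ∑ j : ↥(cubeIdx 28), amc i j * c j + m * vt i,
        ∑ i : ↥(cubeIdx 28), conj (vt i) * c i) = (c, m))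
    (hαM : ∀ (c : ↥(cubeIdx 28) → ℂ) (g : ℂ),
      ∑ j : ↥(cubeIdx 28), ‖(Binv (c, g)).1 j‖ ^ 2 + ‖(Binv (c, g)).2‖ ^ 2 ≤
        ((Row5002C.alpha0 : ℚ) : ℝ) ^ 2 * (∑ i : ↥(cubeIdx 28), ‖c i‖ ^ 2 + ‖g‖ ^ 2))
    (hβBM : ∀ w : Idx → ℂ,
      ∑ j : ↥(cubeIdx 28), ‖(Binv (fun i : ↥(cubeIdx 28) => -∑ j ∈ nbrIdx i \ cubeIdx 28,
          amc i j * w j, 0)).1 j‖ ^ 2 +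
        ‖(Binv (fun i : ↥(cubeIdx 28) => -∑ j ∈ nbrIdx i \ cubeIdx 28,
          amc i j * w j, 0)).2‖ ^ 2 ≤
        ((Row5002C.betaB : ℚ) : ℝ) ^ 2 * ∑ j ∈ (cubeIdx 28).biUnion nbrIdx \ cubeIdx 28, ‖w j‖ ^ 2)
    (hβCM : ∀ (c : ↥(cubeIdx 28) → ℂ) (g : ℂ),
      ∑ i ∈ ((cubeIdx 28).biUnion nbrIdx ∪ cubeIdx 112) \ cubeIdx 28,
        ‖-∑ j : ↥(cubeIdx 28), amc i j * (Binv (c, g)).1 j +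
          (Binv (c, g)).2 * vt i‖ ^ 2 ≤
        ((Row5002C.betaC : ℚ) : ℝ) ^ 2 * (∑ i : ↥(cubeIdx 28), ‖c i‖ ^ 2 + ‖g‖ ^ 2))
    (hgBM : ∀ w : Idx → ℂ,
      ‖(Binv (fun i : ↥(cubeIdx 28) => ∑ j ∈ nbrIdx i \ cubeIdx 28,
          amc i j * w j, 0)).2‖ ^ 2 ≤
        (((2198037866660847 : ℚ) / 562949953421312 : ℚ) : ℝ) ^ 2 *
          ∑ j ∈ (cubeIdx 28).biUnion nbrIdx \ cubeIdx 28, ‖w j‖ ^ 2)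
    (hshellM : ∀ w : Idx → ℂ, (∀ i ∈ cubeIdx 28, w i = 0) →
      (((628200374963231 : ℚ) / 1125899906842624 : ℚ) : ℝ) * ∑ i ∈ cubeIdx (28 + 1) \ cubeIdx 28, ‖w i‖ ^ 2 ≤
        ∑ i ∈ cubeIdx (28 + 1) \ cubeIdx 28,
          ((((Row5002C.lamRe : ℚ) : ℝ) : ℂ).re - (-(onormSq i.1 / 500)) - Real.sqrt 2) * ‖w i‖ ^ 2 -
        RCLike.re (∑ i ∈ (cubeIdx 28).biUnion nbrIdx \ cubeIdx 28,
          conj (∑ j : ↥(cubeIdx 28), amc i j *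
            (Binv (fun i : ↥(cubeIdx 28) => ∑ j ∈ nbrIdx i \ cubeIdx 28,
              amc i j * w j, 0)).1 j) * w i))
    {HL HH HB : Finset Idx}
    (hHL : ∀ i : Idx, i ∈ HL ↔ onormSq i.1 ≤ (36 : ℝ) ^ 2)
    (hHH : ∀ i : Idx, i ∈ HH ↔ onormSq i.1 ≤ (37 : ℝ) ^ 2)
    (hHB : ∀ i : Idx, i ∈ HB ↔ (37 : ℝ) ^ 2 < onormSq i.1 ∧ onormSq i.1 ≤ ((37 : ℝ) + 1) ^ 2)
    (GH' Ah' : Matrix ↥HH ↥HH ℝ) (AHB' : Matrix ↥HH ↥HB ℝ) (ABH' : Matrix ↥HB ↥HH ℝ) (E : ↥HB → ℝ)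
    (V' : Matrix ↥HH (Fin 1) ℝ) (hGH' : GH'ᵀ = GH')
    (hAh' : Ah' = Matrix.of fun i j : ↥HH =>
      (if i = j then -(onormSq i.1.1 / (500 : ℝ)) - (6 / 25 : ℝ) else 0) + am i.1 j.1)
    (hAHB' : AHB' = Matrix.of fun (i : ↥HH) (l : ↥HB) => am i.1 l.1)
    (hABH' : ABH' = Matrix.of fun (l : ↥HB) (i : ↥HH) => am l.1 i.1)
    (hE : E = fun l : ↥HB => onormSq l.1.1 / (500 : ℝ) + (6 / 25 : ℝ) - Real.sqrt 2)
    (hR1' : ∀ x : ↥HH → ℝ, x ≠ 0 →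
      x ⬝ᵥ ((GH' * Ah' + Ah'ᵀ * GH' + (1 / 2 : ℝ) • ((GH' * AHB' + ABH'ᵀ) * Matrix.diagonal (fun l => (E l)⁻¹) *
        (GH' * AHB' + ABH'ᵀ)ᵀ)) *ᵥ x) < 0)
    (hR2' : ∀ x : ↥HH → ℝ, 0 ≤ x ⬝ᵥ ((GH' + V' * V'ᵀ) *ᵥ x))
    (vtI : AbcClassI.Idx → ℂ) (hvt0I : ∀ i, i ∉ AbcClassI.cubeIdx 112 → vtI i = 0)
    (hresI : ∑ i ∈ AbcClassI.cubeIdx 112 ∪ (AbcClassI.cubeIdx 112).biUnion AbcClassI.nbrIdx,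
      ‖(if i ∈ AbcClassI.cubeIdx 112 then (((((Row5001C.lamRe : ℚ) : ℝ) : ℂ) + (((Row5001C.lamIm : ℚ) : ℝ) : ℂ) * Complex.I) - ((-(onormSq i.1 / 500) : ℝ) : ℂ)) * vtI i
          else 0) - ∑ j ∈ AbcClassI.cubeIdx 112, amcI i j * vtI j‖ ^ 2 ≤ ((Row5001C.rnorm : ℚ) : ℝ) ^ 2)
    (hntbI : ∑ i ∈ AbcClassI.cubeIdx 112 \ AbcClassI.cubeIdx 28, ‖vtI i‖ ^ 2 ≤
      (((8161754834082577 : ℚ) / 1152921504606846976 : ℚ) : ℝ) ^ 2)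
    (BinvI : ((↥(AbcClassI.cubeIdx 28) → ℂ) × ℂ) →ₗ[ℂ] ((↥(AbcClassI.cubeIdx 28) → ℂ) × ℂ))
    (hBinvI : ∀ (c : ↥(AbcClassI.cubeIdx 28) → ℂ) (m : ℂ),
      BinvI (fun i : ↥(AbcClassI.cubeIdx 28) =>
          (((((Row5001C.lamRe : ℚ) : ℝ) : ℂ) + (((Row5001C.lamIm : ℚ) : ℝ) : ℂ) * Complex.I) - ((-(onormSq i.1.1 / 500) : ℝ) : ℂ)) * c i -
          ∑ j : ↥(AbcClassI.cubeIdx 28), amcI i j * c j + m * vtI i,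
        ∑ i : ↥(AbcClassI.cubeIdx 28), conj (vtI i) * c i) = (c, m))
    (hαMI : ∀ (c : ↥(AbcClassI.cubeIdx 28) → ℂ) (g : ℂ),
      ∑ j : ↥(AbcClassI.cubeIdx 28), ‖(BinvI (c, g)).1 j‖ ^ 2 + ‖(BinvI (c, g)).2‖ ^ 2 ≤
        ((Row5001C.alpha0 : ℚ) : ℝ) ^ 2 * (∑ i : ↥(AbcClassI.cubeIdx 28), ‖c i‖ ^ 2 + ‖g‖ ^ 2))
    (hβBMI : ∀ w : AbcClassI.Idx → ℂ,
      ∑ j : ↥(AbcClassI.cubeIdx 28), ‖(BinvI (fun i : ↥(AbcClassI.cubeIdx 28) => -∑ j ∈ AbcClassI.nbrIdx i \ AbcClassI.cubeIdx 28,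
          amcI i j * w j, 0)).1 j‖ ^ 2 +
        ‖(BinvI (fun i : ↥(AbcClassI.cubeIdx 28) => -∑ j ∈ AbcClassI.nbrIdx i \ AbcClassI.cubeIdx 28,
          amcI i j * w j, 0)).2‖ ^ 2 ≤
        ((Row5001C.betaB : ℚ) : ℝ) ^ 2 * ∑ j ∈ (AbcClassI.cubeIdx 28).biUnion AbcClassI.nbrIdx \ AbcClassI.cubeIdx 28, ‖w j‖ ^ 2)
    (hβCMI : ∀ (c : ↥(AbcClassI.cubeIdx 28) → ℂ) (g : ℂ),
      ∑ i ∈ ((AbcClassI.cubeIdx 28).biUnion AbcClassI.nbrIdx ∪ AbcClassI.cubeIdx 112) \ AbcClassI.cubeIdx 28,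
        ‖-∑ j : ↥(AbcClassI.cubeIdx 28), amcI i j * (BinvI (c, g)).1 j +
          (BinvI (c, g)).2 * vtI i‖ ^ 2 ≤
        ((Row5001C.betaC : ℚ) : ℝ) ^ 2 * (∑ i : ↥(AbcClassI.cubeIdx 28), ‖c i‖ ^ 2 + ‖g‖ ^ 2))
    (hgBMI : ∀ w : AbcClassI.Idx → ℂ,
      ‖(BinvI (fun i : ↥(AbcClassI.cubeIdx 28) => ∑ j ∈ AbcClassI.nbrIdx i \ AbcClassI.cubeIdx 28,
          amcI i j * w j, 0)).2‖ ^ 2 ≤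
        (((3449790300190025 : ℚ) / 2251799813685248 : ℚ) : ℝ) ^ 2 *
          ∑ j ∈ (AbcClassI.cubeIdx 28).biUnion AbcClassI.nbrIdx \ AbcClassI.cubeIdx 28, ‖w j‖ ^ 2)
    (hshellMI : ∀ w : AbcClassI.Idx → ℂ, (∀ i ∈ AbcClassI.cubeIdx 28, w i = 0) →
      (((4982293683959657 : ℚ) / 9007199254740992 : ℚ) : ℝ) * ∑ i ∈ AbcClassI.cubeIdx (28 + 1) \ AbcClassI.cubeIdx 28, ‖w i‖ ^ 2 ≤
        ∑ i ∈ AbcClassI.cubeIdx (28 + 1) \ AbcClassI.cubeIdx 28,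
          (((((Row5001C.lamRe : ℚ) : ℝ) : ℂ) + (((Row5001C.lamIm : ℚ) : ℝ) : ℂ) * Complex.I).re - (-(onormSq i.1 / 500)) - Real.sqrt 2) * ‖w i‖ ^ 2 -
        RCLike.re (∑ i ∈ (AbcClassI.cubeIdx 28).biUnion AbcClassI.nbrIdx \ AbcClassI.cubeIdx 28,
          conj (∑ j : ↥(AbcClassI.cubeIdx 28), amcI i j *
            (BinvI (fun i : ↥(AbcClassI.cubeIdx 28) => ∑ j ∈ AbcClassI.nbrIdx i \ AbcClassI.cubeIdx 28,
              amcI i j * w j, 0)).1 j) * w i))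
    {HLI HHI HBI : Finset AbcClassI.Idx}
    (hHLI : ∀ i : AbcClassI.Idx, i ∈ HLI ↔ onormSq i.1 ≤ (36 : ℝ) ^ 2)
    (hHHI : ∀ i : AbcClassI.Idx, i ∈ HHI ↔ onormSq i.1 ≤ (37 : ℝ) ^ 2)
    (hHBI : ∀ i : AbcClassI.Idx, i ∈ HBI ↔ (37 : ℝ) ^ 2 < onormSq i.1 ∧ onormSq i.1 ≤ ((37 : ℝ) + 1) ^ 2)
    (GHI AhI : Matrix ↥HHI ↥HHI ℝ) (AHBI : Matrix ↥HHI ↥HBI ℝ) (ABHI : Matrix ↥HBI ↥HHI ℝ) (EI : ↥HBI → ℝ)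
    (VI : Matrix ↥HHI (Fin 2) ℝ) (hGHI : GHIᵀ = GHI)
    (hAhI : AhI = Matrix.of fun i j : ↥HHI =>
      (if i = j then -(onormSq i.1.1 / (500 : ℝ)) - (1 / 4 : ℝ) else 0) + amI i.1 j.1)
    (hAHBI : AHBI = Matrix.of fun (i : ↥HHI) (l : ↥HBI) => amI i.1 l.1)
    (hABHI : ABHI = Matrix.of fun (l : ↥HBI) (i : ↥HHI) => amI l.1 i.1)
    (hEI : EI = fun l : ↥HBI => onormSq l.1.1 / (500 : ℝ) + (1 / 4 : ℝ) - Real.sqrt 2)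
    (hR1I : ∀ x : ↥HHI → ℝ, x ≠ 0 →
      x ⬝ᵥ ((GHI * AhI + AhIᵀ * GHI + (1 / 2 : ℝ) • ((GHI * AHBI + ABHIᵀ) * Matrix.diagonal (fun l => (EI l)⁻¹) *
        (GHI * AHBI + ABHIᵀ)ᵀ)) *ᵥ x) < 0)
    (hR2I : ∀ x : ↥HHI → ℝ, 0 ≤ x ⬝ᵥ ((GHI + VI * VIᵀ) *ᵥ x)) :
    ∃ lamII lamI : ℂ,
      ‖lamII - (((Row5002C.lamRe : ℚ) : ℝ) : ℂ)‖ ≤ ((Row5002C.rho : ℚ) : ℝ) ∧ lamII.im = 0 ∧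
      ‖lamI - ((((Row5001C.lamRe : ℚ) : ℝ) : ℂ) + (((Row5001C.lamIm : ℚ) : ℝ) : ℂ) * Complex.I)‖ ≤
        ((Row5001C.rho : ℚ) : ℝ) ∧ 0 < lamI.im ∧ lamI.re < lamII.re ∧
      (∃ u : UnitAddTorus (Fin 3) → EuclideanSpace ℂ (Fin 3),
        Torus.LinNSResolventRel (1 / (2 * Real.pi * 500)) (Torus.abcFlow 1 1 1) (2 * Real.pi * lamII) u 0 ∧
          u ≠ 0 ∧ IsClassII (mFourierCoeff u)) ∧
      (∃ u : UnitAddTorus (Fin 3) → EuclideanSpace ℂ (Fin 3),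
        Torus.LinNSResolventRel (1 / (2 * Real.pi * 500)) (Torus.abcFlow 1 1 1) (2 * Real.pi * lamI) u 0 ∧
          u ≠ 0 ∧ IsClassI (mFourierCoeff u)) ∧
      (∃ u : UnitAddTorus (Fin 3) → EuclideanSpace ℂ (Fin 3),
        Torus.LinNSResolventRel (1 / (2 * Real.pi * 500)) (Torus.abcFlow 1 1 1) (2 * Real.pi * conj lamI) u 0 ∧
          u ≠ 0 ∧ IsClassI (mFourierCoeff u)) ∧
      (∀ (z : ℂ) (u : UnitAddTorus (Fin 3) → EuclideanSpace ℂ (Fin 3)),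
        Torus.LinNSResolventRel (1 / (2 * Real.pi * 500)) (Torus.abcFlow 1 1 1) (2 * Real.pi * z) u 0 → u ≠ 0 →
          IsClassII (mFourierCoeff u) → (6 / 25 : ℝ) ≤ z.re → z = lamII) ∧
      (∀ (z : ℂ) (u : UnitAddTorus (Fin 3) → EuclideanSpace ℂ (Fin 3)),
        Torus.LinNSResolventRel (1 / (2 * Real.pi * 500)) (Torus.abcFlow 1 1 1) (2 * Real.pi * z) u 0 → u ≠ 0 →
          IsClassI (mFourierCoeff u) → (1 / 4 : ℝ) ≤ z.re → z = lamI ∨ z = conj lamI) ∧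
      ∀ (z : ℂ) (u : UnitAddTorus (Fin 3) → EuclideanSpace ℂ (Fin 3)),
        Torus.LinNSResolventRel (1 / (2 * Real.pi * 500)) (Torus.abcFlow 1 1 1) (2 * Real.pi * z) u 0 → u ≠ 0 →
          IsClassI (mFourierCoeff u) → z.re < lamII.re := by
  obtain ⟨lamII, hcloseII, himII, hreloII, honeII, huniqII⟩ :=
    AbcInertia.R500II_exactly_one_tight_i4 wf hws hwt hwII hwon amc hamc e bf hbf am ham vt hvt0 hres hntb Binv hBinv
      hαM hβBM hβCM hgBM hshellM hHL hHH hHB GH' Ah' AHB' ABH' E V' hGH' hAh' hAHB' hABH' hE hR1' hR2'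
  obtain ⟨lamI, hcloseI, hreloI, himI, hpairI, hpaircI, huniqI⟩ :=
    AbcInertiaCI.R500I_exactly_pair_i4_of_bases wfI hwsI hwtI hwI hwonI amcI hamcI eI brI hbrI amI hamI vtI hvt0I hresI hntbI BinvI hBinvI
      hαMI hβBMI hβCMI hgBMI hshellMI hHLI hHHI hHBI GHI AhI AHBI ABHI EI VI hGHI hAhI hAHBI hABHI hEI hR1I hR2I
  have hlt : (((((Row5001C.lamRe : ℚ) : ℝ) : ℂ) + (((Row5001C.lamIm : ℚ) : ℝ) : ℂ) * Complex.I)).re =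
      ((Row5001C.lamRe : ℚ) : ℝ) := by simp
  have hcon := lead_of_exactly_pair (ν := 1 / (2 * Real.pi * 500)) hlt row5001C_add_rho_lt_row5002C_sub_rho
    AbcInertiaCI.a_le_row5001C lamI hcloseI huniqI lamII hreloII
  obtain ⟨uI, huI, huI0, huIcl⟩ := hpairI
  exact ⟨lamII, lamI, hcloseII, himII, hcloseI, himI, hcon lamI uI huI huI0 huIcl, honeII, ⟨uI, huI, huI0, huIcl⟩,
    hpaircI, huniqII, huniqI, hcon⟩

end Rows

end Summit.NavierStokesRegularity.FluidComputer.AbcContestI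

end
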